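import Literature.AnabelianGeometry.AbsoluteAnabelian.AbsTopISemiAbsolute
import Literature.AnabelianGeometry.AbsoluteAnabelian.ProfiniteRankProofs
import Literature.AnabelianGeometry.AbsoluteAnabelian.GaloisSubextensionProofs
import Mathlib.Topology.Algebra.ClopenNhdofOne
import Mathlib.Data.Nat.Find
import HarnessLib

/-!
# An elasticity criterion for profinite groups from a LINEAR rank formula ([AbsTopI] Thm 1.7 (ii) route)

S. Mochizuki, *Topics in Absolute Anabelian Geometry I: Generalities* (2012) [AbsTopI] (lit key
`paper:url-11ac98ba15fc`), Def 1.1 (ii) p. 10 ("`G` is *elastic* if every topologically finitely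
generated closed normal subgroup `N ⊆ H` of an open subgroup `H ⊆ G` of `G` is either trivial or of
finite index") and Thm 1.7 (ii) p. 14 ("If `k` is an MLF, then `G_k` [...] is elastic"), whose printed
proof (pp. 14–15) runs through the free pro-`p` structure of the maximal pro-`p` quotient (Prop 1.6
(iii), [NSW] 7.5.8, [RZ] 7.7.4, Lubotzky–Melnikov–van den Dries).  abc-iut cell GAP-LEDGER row
G-w5d206-1 (the one named input of abc-iut-w5-d206's discharge of [AbsTopI] Thm 2.6 (iv),
`thm26iv_of_isElastic_gal`); holder abc-iut-L4-t16, route = an ELEMENTARY RANK ARGUMENT over the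
tree's PROVED rank formula `δ¹_p(U) = [k_U : ℚ_p] + 1` instead of pro-`p` structure theory
(abc-iut-L4-t16 g3, STATUS 2026-08-26T01:40:43Z; this is file (2) of that plan, L4-lead RULINGS #3 (5)
"one file each, named-hypothesis interface").

THIS PROOF-ONLY FILE (abc-iut-L4-t15) proves the GROUP-THEORETIC CRITERION, with the key rank lemma
of file (1) carried as an explicit hypothesis `hKey` (stated here in the exact shape consumed; file (1)
`ElasticityRankLemmaProofs.lean`, abc-iut-L4-t16, proves it):

* `isElastic_of_freeProlRank_open_eq` — let `Γ` be profinite (compact, Hausdorff, totally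
  disconnected) and suppose that for some prime `p` and some `c ≥ 1`, EVERY open subgroup `U ⊆ Γ` has
  free pro-`p` rank `δ¹_p(U) = c · [Γ : U] + 1` (for `Γ = G_k`, `k/ℚ_p` finite: `c = [k : ℚ_p]`, the
  landed `thm26_ii_delta_gal_holds` transported along `U = G_{k′}`).  Then `Γ` is elastic.

PROOF.  Let `N ⊴ H` (`H ⊆ Γ` open) be closed, topologically finitely generated, `N ≠ 1`, of infinite
index; pick `σ ∈ N ∖ {1}` and an open normal `U₀ ⊴ Γ` with `U₀ ⊆ H ∖ {σ}`; put `G₁ := U₀·⟨σ⟩`,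
`N₁ := N ∩ G₁`, `M := N ∩ U₀` (topologically finitely generated, so `d := δ¹_p(M) < ∞`).  For every
open `V` with `N₁ ⊆ V ⊆ G₁` put `V′ := V ∩ U₀`: `V = V′·⟨σ⟩`, `[V : V′] = [G₁ : U₀] =: f ≥ 2`, and
`[σ, V′] ⊆ N ∩ U₀ = M ⊆ V′`, so the KEY LEMMA gives `δ¹_p(V′) ≤ δ¹_p(V) + d`, i.e.
`c·f·[Γ : V] + 1 ≤ c·[Γ : V] + 1 + d`, whence `[Γ : V] ≤ d`.  An admissible `V₀` of maximal index then
lies in every admissible `V`, hence in `⋂_V V = N₁` (a closed subgroup of a profinite group is the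
intersection of the open subgroups containing it) — so `N₁`, and with it `N`, has finite index:
contradiction.  (The KEY LEMMA: characters of `V′` killing `M` are `σ`-invariant, `σ`-invariant
characters extend to `V` after multiplication by `f`, the others restrict injectively to `M`.)

HONEST FRAMING: classical profinite group theory; the key lemma is an explicit hypothesis here;
nothing in this file bears on [IUTchIII] Cor 3.12; typed ≠ proved elsewhere.
-/

noncomputable section

open Topology
open scoped Pointwise

universe u

namespace Literature.AnabelianGeometry.AbsoluteAnabelian

variable {Γ : Type u} [Group Γ] [TopologicalSpace Γ] [IsTopologicalGroup Γ]

section Helpers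

omit [TopologicalSpace Γ] [IsTopologicalGroup Γ] in
/-- Two subgroups `K ≤ L` of the same finite nonzero index are equal. [folklore] -/
private theorem eq_of_le_of_index_eq {K L : Subgroup Γ} (hKL : K ≤ L) (hL : L.index ≠ 0)
    (h : K.index = L.index) : K = L := by
  refine le_antisymm hKL ?_
  have h1 := Subgroup.relIndex_mul_index hKL
  rw [h] at h1
  have h2 : K.relIndex L = 1 := by
    have : K.relIndex L * L.index = 1 * L.index := by rw [one_mul]; exact h1
    exact Nat.eq_of_mul_eq_mul_right (Nat.pos_of_ne_zero hL) this
  exact Subgroup.relIndex_eq_one.mp h2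

/-- The free pro-`p` rank of `N ∩ U₀` is finite when `N` is closed, topologically finitely generated,
in a compact group and `U₀` is open (an open subgroup of a compact tfg group is tfg).
[cite: MochizukiAbsTopI2012, §0 p.8] -/
private theorem freeProlRank_inf_ne_top [CompactSpace Γ] (p : ℕ) [Fact p.Prime] {N U₀ : Subgroup Γ}
    (hNc : IsClosed (N : Set Γ)) (hNfg : IsTopologicallyFinitelyGenerated N)
    (hU₀ : IsOpen (U₀ : Set Γ)) : freeProlRank ↥(N ⊓ U₀) p ≠ ⊤ := by
  haveI : CompactSpace N := isCompact_iff_compactSpace.mp hNc.isCompact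
  -- `U₀ ∩ N` as an open subgroup of `N` is topologically finitely generated
  have hopen : IsOpen ((U₀.subgroupOf N : Subgroup N) : Set N) := by
    rw [Subgroup.coe_subgroupOf]
    exact hU₀.preimage continuous_subtype_val
  have htfg : IsTopologicallyFinitelyGenerated ↥(U₀.subgroupOf N) := hNfg.subgroup_isOpen _ hopen
  -- transport along the obvious continuous surjection onto `N ⊓ U₀`
  let φ : ↥(U₀.subgroupOf N) →ₜ* ↥(N ⊓ U₀) :=
    { toFun := fun x => ⟨(x.1 : Γ), ⟨x.1.2, Subgroup.mem_subgroupOf.mp x.2⟩⟩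
      map_one' := rfl
      map_mul' := fun _ _ => rfl
      continuous_toFun := Continuous.subtype_mk
        (continuous_subtype_val.comp continuous_subtype_val) _ }
  have hφ : Function.Surjective φ := by
    rintro ⟨y, hyN, hyU⟩
    exact ⟨⟨⟨y, hyN⟩, Subgroup.mem_subgroupOf.mpr hyU⟩, rfl⟩
  exact ne_top_of_le_ne_top (freeProlRank_ne_top_of_tfg htfg p) (freeProlRank_le_of_surjective φ hφ p)

end Helpers

/-- **Elasticity from a linear rank formula** ([AbsTopI] Thm 1.7 (ii) route of GAP row G-w5d206-1,
group-theoretic part): let `Γ` be a profinite group and suppose that, for a prime `p` and an integer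
`c ≥ 1`, every open subgroup `U ⊆ Γ` has `δ¹_p(U) = c · [Γ : U] + 1`, and that the KEY RANK LEMMA
`hKey` holds in `Γ` (for `V = V′·⟨σ⟩` with `V′ ⊴ V` open and `[σ, V′] ⊆ M ⊆ V′`:
`δ¹_p(V′) ≤ δ¹_p(V) + δ¹_p(M)`).  Then `Γ` is ELASTIC: every topologically finitely generated closed
normal subgroup of an open subgroup of `Γ` is trivial or of finite index.
[cite: MochizukiAbsTopI2012, Thm 1.7 (ii) p.14] -/
theorem isElastic_of_freeProlRank_open_eq [CompactSpace Γ] [T2Space Γ] [TotallyDisconnectedSpace Γ]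
    (p c : ℕ) [Fact p.Prime] (hc : 0 < c)
    (hRF : ∀ U : Subgroup Γ, IsOpen (U : Set Γ) → freeProlRank U p = ((c * U.index + 1 : ℕ) : ℕ∞))
    (hKey : ∀ (V V' M : Subgroup Γ) (σ : Γ), IsOpen (V' : Set Γ) → V' ≤ V → M ≤ V' → σ ∈ V →
      V' ⊔ Subgroup.zpowers σ = V → (V'.subgroupOf V).Normal →
      (∀ v ∈ V', σ * v * σ⁻¹ * v⁻¹ ∈ M) →
      freeProlRank V' p ≤ freeProlRank V p + freeProlRank M p) :
    IsElastic Γ := by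
  classical
  refine ⟨fun H N hHo hNH hNn hNc hNfg => ?_⟩
  by_contra hcon
  push Not at hcon
  obtain ⟨hNne, hNinf⟩ := hcon
  -- an element `σ ≠ 1` of `N`
  obtain ⟨σ, hσN, hσ1⟩ := (N.bot_or_exists_ne_one).resolve_left hNne
  -- an open normal `U₀ ⊴ Γ` inside `H` and avoiding `σ`
  obtain ⟨W, hW⟩ := ProfiniteGrp.exist_openNormalSubgroup_sub_open_nhds_of_one
    (U := (H : Set Γ) ∩ {σ}ᶜ) (hHo.inter isOpen_compl_singleton) ⟨H.one_mem, fun h => hσ1 h.symm⟩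
  set U₀ : Subgroup Γ := (W : Subgroup Γ) with hU₀def
  haveI hU₀n : U₀.Normal := W.isNormal'
  have hU₀o : IsOpen (U₀ : Set Γ) := W.isOpen'
  have hU₀H : U₀ ≤ H := fun x hx => (hW hx).1
  have hσU₀ : σ ∉ U₀ := fun h => (hW h).2 rfl
  haveI : Finite (Γ ⧸ U₀) := Subgroup.quotient_finite_of_isOpen U₀ hU₀o
  haveI hU₀fi : U₀.FiniteIndex := Subgroup.finiteIndex_of_finite_quotient
  -- `G₁ := U₀ · ⟨σ⟩`, `N₁ := N ∩ G₁`, `M := N ∩ U₀`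
  set G₁ : Subgroup Γ := U₀ ⊔ Subgroup.zpowers σ with hG₁
  have hσG₁ : σ ∈ G₁ := Subgroup.mem_sup_right (Subgroup.mem_zpowers σ)
  have hU₀G₁ : U₀ ≤ G₁ := le_sup_left
  have hG₁o : IsOpen (G₁ : Set Γ) := Subgroup.isOpen_mono hU₀G₁ hU₀o
  have hG₁H : G₁ ≤ H := sup_le hU₀H ((Subgroup.zpowers_le).mpr (hNH hσN))
  set M : Subgroup Γ := N ⊓ U₀ with hM
  -- the index `f := [G₁ : U₀] ≥ 2`
  set f : ℕ := U₀.relIndex G₁ with hf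
  have hf0 : f ≠ 0 := fun h0 =>
    hU₀fi.index_ne_zero (Nat.eq_zero_of_zero_dvd (h0 ▸ Subgroup.relIndex_dvd_index_of_le hU₀G₁))
  have hf1 : f ≠ 1 := fun h1 => hσU₀ ((Subgroup.relIndex_eq_one.mp h1) hσG₁)
  have hf2 : 2 ≤ f := by omega
  -- `d := δ¹_p(M) < ∞`
  obtain ⟨d, hd⟩ := ENat.ne_top_iff_exists.mp (freeProlRank_inf_ne_top p hNc hNfg hU₀o (N := N) (U₀ := U₀))
  -- admissible open subgroups: `N ∩ G₁ ⊆ V ⊆ G₁`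
  set Adm : Subgroup Γ → Prop := fun V => IsOpen (V : Set Γ) ∧ N ⊓ G₁ ≤ V ∧ V ≤ G₁ with hAdm
  -- the index bound `[Γ : V] ≤ d` for admissible `V`
  have hbound : ∀ V : Subgroup Γ, Adm V → V.index ≤ d := by
    rintro V ⟨hVo, hNV, hVG₁⟩
    haveI : Finite (Γ ⧸ V) := Subgroup.quotient_finite_of_isOpen V hVo
    haveI hVfi : V.FiniteIndex := Subgroup.finiteIndex_of_finite_quotient
    have hσV : σ ∈ V := hNV ⟨hσN, hσG₁⟩
    set V' : Subgroup Γ := V ⊓ U₀ with hV'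
    have hV'o : IsOpen (V' : Set Γ) := hVo.inter hU₀o
    have hV'V : V' ≤ V := inf_le_left
    -- `V = V' · ⟨σ⟩`
    have hgen : V' ⊔ Subgroup.zpowers σ = V := by
      refine le_antisymm (sup_le hV'V ((Subgroup.zpowers_le).mpr hσV)) fun v hv => ?_
      have hvG₁ : v ∈ G₁ := hVG₁ hv
      rw [hG₁, ← SetLike.mem_coe, Subgroup.normal_mul] at hvG₁
      obtain ⟨u, hu, w, hw, rfl⟩ := Set.mem_mul.mp hvG₁
      have hwV : w ∈ V := (Subgroup.zpowers_le.mpr hσV) hw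
      have huV : u ∈ V := by
        have : u * w * w⁻¹ ∈ V := V.mul_mem hv (V.inv_mem hwV)
        rwa [mul_inv_cancel_right] at this
      exact Subgroup.mul_mem_sup ⟨huV, hu⟩ hw
    -- `V' ⊴ V`
    have hV'n : (V'.subgroupOf V).Normal := by
      rw [hV', Subgroup.inf_subgroupOf_left]
      exact Subgroup.Normal.subgroupOf hU₀n V
    -- `[σ, V'] ⊆ M ⊆ V'`
    have hMV' : M ≤ V' := fun x hx => ⟨hNV ⟨hx.1, hU₀G₁ hx.2⟩, hx.2⟩
    have hcomm : ∀ v ∈ V', σ * v * σ⁻¹ * v⁻¹ ∈ M := by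
      intro v hv
      refine ⟨?_, ?_⟩
      · -- in `N`: `σ · (v σ⁻¹ v⁻¹)` with `v σ⁻¹ v⁻¹ ∈ N` (`N ⊴ H`, `v ∈ H`)
        have hvH : v ∈ H := hG₁H (hVG₁ (hV'V hv))
        have h1 : v * σ⁻¹ * v⁻¹ ∈ N := by
          have := hNn.conj_mem ⟨σ⁻¹, hNH (N.inv_mem hσN)⟩ (by
            rw [Subgroup.mem_subgroupOf]; exact N.inv_mem hσN) ⟨v, hvH⟩
          rw [Subgroup.mem_subgroupOf] at this
          simpa using this
        have : σ * (v * σ⁻¹ * v⁻¹) ∈ N := N.mul_mem hσN h1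
        simpa [mul_assoc] using this
      · -- in `U₀`: `(σ v σ⁻¹) · v⁻¹` with `U₀ ⊴ Γ`
        have h1 : σ * v * σ⁻¹ ∈ U₀ := hU₀n.conj_mem v hv.2 σ
        exact U₀.mul_mem h1 (U₀.inv_mem hv.2)
    -- the key lemma
    have hkey := hKey V V' M σ hV'o hV'V hMV' hσV hgen hV'n hcomm
    -- `[V : V'] = f` and `[Γ : V'] = f · [Γ : V]`
    have hrel : V'.relIndex V = f := by
      rw [hV', inf_comm, Subgroup.inf_relIndex_right, hf, ← Subgroup.relIndex_sup_left,
        show U₀ ⊔ V = G₁ from le_antisymm (sup_le hU₀G₁ hVG₁)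
          (sup_le le_sup_left ((Subgroup.zpowers_le.mpr hσV).trans le_sup_right))]
    have hidx : V'.index = f * V.index := by
      rw [← Subgroup.relIndex_mul_index hV'V, hrel]
    -- numerics
    rw [hRF V' hV'o, hRF V hVo, hM, ← hd, hidx] at hkey
    have hnum : c * (f * V.index) + 1 ≤ c * V.index + 1 + d := by exact_mod_cast hkey
    have h2 : c * V.index + V.index ≤ c * (f * V.index) := by
      have : V.index + V.index ≤ f * V.index := by nlinarith
      nlinarith
    omega
  -- an admissible subgroup of maximal index
  have hAdmG₁ : Adm G₁ := ⟨hG₁o, inf_le_right, le_rfl⟩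
  set n₀ := Nat.findGreatest (fun n => ∃ V, Adm V ∧ V.index = n) d with hn₀
  obtain ⟨V₀, hV₀, hV₀idx⟩ : ∃ V, Adm V ∧ V.index = n₀ :=
    Nat.findGreatest_spec (P := fun n => ∃ V, Adm V ∧ V.index = n) (hbound G₁ hAdmG₁) ⟨G₁, hAdmG₁, rfl⟩
  haveI : Finite (Γ ⧸ V₀) := Subgroup.quotient_finite_of_isOpen V₀ hV₀.1
  haveI hV₀fi : V₀.FiniteIndex := Subgroup.finiteIndex_of_finite_quotient
  -- `V₀` lies in every admissible `V`
  have hV₀le : ∀ V, Adm V → V₀ ≤ V := by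
    intro V hV
    have hAdm' : Adm (V ⊓ V₀) :=
      ⟨hV.1.inter hV₀.1, le_inf hV.2.1 hV₀.2.1, inf_le_right.trans hV₀.2.2⟩
    have hle : (V ⊓ V₀).index ≤ n₀ :=
      Nat.le_findGreatest (P := fun n => ∃ V, Adm V ∧ V.index = n) (hbound _ hAdm') ⟨_, hAdm', rfl⟩
    have hge : V₀.index ≤ (V ⊓ V₀).index :=
      Nat.le_of_dvd (Nat.pos_of_ne_zero (by
        haveI : Finite (Γ ⧸ (V ⊓ V₀)) := Subgroup.quotient_finite_of_isOpen _ hAdm'.1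
        exact (Subgroup.finiteIndex_of_finite_quotient (H := V ⊓ V₀)).index_ne_zero))
        (Subgroup.index_dvd_of_le inf_le_right)
    have heq : V ⊓ V₀ = V₀ :=
      eq_of_le_of_index_eq inf_le_right hV₀fi.index_ne_zero (le_antisymm (hV₀idx ▸ hle) hge)
    exact (le_of_eq heq.symm).trans inf_le_left
  -- hence `V₀ ≤ N ∩ G₁`: a closed subgroup of a profinite group is the meet of the opens above it
  have hN₁c : IsClosed ((N ⊓ G₁ : Subgroup Γ) : Set Γ) :=
    hNc.inter (Subgroup.isClosed_of_isOpen G₁ hG₁o)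
  have hN₁ : (N ⊓ G₁ : Subgroup Γ) =
      sInf {W : Subgroup Γ | IsOpen (W : Set Γ) ∧ N ⊓ G₁ ≤ W} :=
    ProfiniteGrp.closedSubgroup_eq_sInf_open ⟨N ⊓ G₁, hN₁c⟩
  have hV₀N₁ : V₀ ≤ N ⊓ G₁ := by
    rw [hN₁]
    refine le_sInf fun W hW => ?_
    exact (hV₀le (W ⊓ G₁) ⟨hW.1.inter hG₁o, le_inf hW.2 inf_le_right, inf_le_right⟩).trans inf_le_left
  -- so `N` has finite index: contradiction
  haveI : (N ⊓ G₁).FiniteIndex := Subgroup.finiteIndex_of_le hV₀N₁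
  exact hNinf (Subgroup.finiteIndex_of_le (inf_le_left : N ⊓ G₁ ≤ N))

/-- **Elasticity from a linear rank formula — the form the KEY RANK LEMMA is proved in** (GAP row
G-w5d206-1, file (1) `FreeProlRankExtensionProofs.lean`, abc-iut-w5-d206: the inequality
`δ¹_p(V′) ≤ δ¹_p(V) + δ¹_p(M)` is established for CLOSED `M`, compactness of `M` being what turns
independent characters into a surjection `M ↠ ℤ_pʳ`).  Same statement and proof as
`isElastic_of_freeProlRank_open_eq`, with the hypothesis `hKey` WEAKENED to closed `M` — which is all
the argument uses, since there `M = N ∩ U₀` with `N` closed and `U₀` open.  (The un-suffixed version,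
whose `hKey` quantifies over all subgroups `M`, is implied by this one and should be regarded as
superseded: for non-closed `M` the rank `δ¹_p(M)` of the subspace group can collapse, so its `hKey`
is not the statement file (1) supplies.) [cite: MochizukiAbsTopI2012, Thm 1.7 (ii) p.14] -/
theorem isElastic_of_freeProlRank_open_eq_of_isClosed [CompactSpace Γ] [T2Space Γ] [TotallyDisconnectedSpace Γ]
    (p c : ℕ) [Fact p.Prime] (hc : 0 < c)
    (hRF : ∀ U : Subgroup Γ, IsOpen (U : Set Γ) → freeProlRank U p = ((c * U.index + 1 : ℕ) : ℕ∞))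
    (hKey : ∀ (V V' M : Subgroup Γ) (σ : Γ), IsOpen (V' : Set Γ) → V' ≤ V → M ≤ V' → σ ∈ V →
      V' ⊔ Subgroup.zpowers σ = V → (V'.subgroupOf V).Normal →
      (∀ v ∈ V', σ * v * σ⁻¹ * v⁻¹ ∈ M) → IsClosed (M : Set Γ) →
      freeProlRank V' p ≤ freeProlRank V p + freeProlRank M p) :
    IsElastic Γ := by
  classical
  refine ⟨fun H N hHo hNH hNn hNc hNfg => ?_⟩
  by_contra hcon
  push Not at hcon
  obtain ⟨hNne, hNinf⟩ := hcon
  -- an element `σ ≠ 1` of `N`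
  obtain ⟨σ, hσN, hσ1⟩ := (N.bot_or_exists_ne_one).resolve_left hNne
  -- an open normal `U₀ ⊴ Γ` inside `H` and avoiding `σ`
  obtain ⟨W, hW⟩ := ProfiniteGrp.exist_openNormalSubgroup_sub_open_nhds_of_one
    (U := (H : Set Γ) ∩ {σ}ᶜ) (hHo.inter isOpen_compl_singleton) ⟨H.one_mem, fun h => hσ1 h.symm⟩
  set U₀ : Subgroup Γ := (W : Subgroup Γ) with hU₀def
  haveI hU₀n : U₀.Normal := W.isNormal'
  have hU₀o : IsOpen (U₀ : Set Γ) := W.isOpen'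
  have hU₀H : U₀ ≤ H := fun x hx => (hW hx).1
  have hσU₀ : σ ∉ U₀ := fun h => (hW h).2 rfl
  haveI : Finite (Γ ⧸ U₀) := Subgroup.quotient_finite_of_isOpen U₀ hU₀o
  haveI hU₀fi : U₀.FiniteIndex := Subgroup.finiteIndex_of_finite_quotient
  -- `G₁ := U₀ · ⟨σ⟩`, `N₁ := N ∩ G₁`, `M := N ∩ U₀`
  set G₁ : Subgroup Γ := U₀ ⊔ Subgroup.zpowers σ with hG₁
  have hσG₁ : σ ∈ G₁ := Subgroup.mem_sup_right (Subgroup.mem_zpowers σ)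
  have hU₀G₁ : U₀ ≤ G₁ := le_sup_left
  have hG₁o : IsOpen (G₁ : Set Γ) := Subgroup.isOpen_mono hU₀G₁ hU₀o
  have hG₁H : G₁ ≤ H := sup_le hU₀H ((Subgroup.zpowers_le).mpr (hNH hσN))
  set M : Subgroup Γ := N ⊓ U₀ with hM
  -- the index `f := [G₁ : U₀] ≥ 2`
  set f : ℕ := U₀.relIndex G₁ with hf
  have hf0 : f ≠ 0 := fun h0 =>
    hU₀fi.index_ne_zero (Nat.eq_zero_of_zero_dvd (h0 ▸ Subgroup.relIndex_dvd_index_of_le hU₀G₁))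
  have hf1 : f ≠ 1 := fun h1 => hσU₀ ((Subgroup.relIndex_eq_one.mp h1) hσG₁)
  have hf2 : 2 ≤ f := by omega
  -- `d := δ¹_p(M) < ∞`
  obtain ⟨d, hd⟩ := ENat.ne_top_iff_exists.mp (freeProlRank_inf_ne_top p hNc hNfg hU₀o (N := N) (U₀ := U₀))
  -- admissible open subgroups: `N ∩ G₁ ⊆ V ⊆ G₁`
  set Adm : Subgroup Γ → Prop := fun V => IsOpen (V : Set Γ) ∧ N ⊓ G₁ ≤ V ∧ V ≤ G₁ with hAdm
  -- the index bound `[Γ : V] ≤ d` for admissible `V`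
  have hbound : ∀ V : Subgroup Γ, Adm V → V.index ≤ d := by
    rintro V ⟨hVo, hNV, hVG₁⟩
    haveI : Finite (Γ ⧸ V) := Subgroup.quotient_finite_of_isOpen V hVo
    haveI hVfi : V.FiniteIndex := Subgroup.finiteIndex_of_finite_quotient
    have hσV : σ ∈ V := hNV ⟨hσN, hσG₁⟩
    set V' : Subgroup Γ := V ⊓ U₀ with hV'
    have hV'o : IsOpen (V' : Set Γ) := hVo.inter hU₀o
    have hV'V : V' ≤ V := inf_le_left
    -- `V = V' · ⟨σ⟩`
    have hgen : V' ⊔ Subgroup.zpowers σ = V := by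
      refine le_antisymm (sup_le hV'V ((Subgroup.zpowers_le).mpr hσV)) fun v hv => ?_
      have hvG₁ : v ∈ G₁ := hVG₁ hv
      rw [hG₁, ← SetLike.mem_coe, Subgroup.normal_mul] at hvG₁
      obtain ⟨u, hu, w, hw, rfl⟩ := Set.mem_mul.mp hvG₁
      have hwV : w ∈ V := (Subgroup.zpowers_le.mpr hσV) hw
      have huV : u ∈ V := by
        have : u * w * w⁻¹ ∈ V := V.mul_mem hv (V.inv_mem hwV)
        rwa [mul_inv_cancel_right] at this
      exact Subgroup.mul_mem_sup ⟨huV, hu⟩ hw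
    -- `V' ⊴ V`
    have hV'n : (V'.subgroupOf V).Normal := by
      rw [hV', Subgroup.inf_subgroupOf_left]
      exact Subgroup.Normal.subgroupOf hU₀n V
    -- `[σ, V'] ⊆ M ⊆ V'`
    have hMV' : M ≤ V' := fun x hx => ⟨hNV ⟨hx.1, hU₀G₁ hx.2⟩, hx.2⟩
    have hcomm : ∀ v ∈ V', σ * v * σ⁻¹ * v⁻¹ ∈ M := by
      intro v hv
      refine ⟨?_, ?_⟩
      · -- in `N`: `σ · (v σ⁻¹ v⁻¹)` with `v σ⁻¹ v⁻¹ ∈ N` (`N ⊴ H`, `v ∈ H`)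
        have hvH : v ∈ H := hG₁H (hVG₁ (hV'V hv))
        have h1 : v * σ⁻¹ * v⁻¹ ∈ N := by
          have := hNn.conj_mem ⟨σ⁻¹, hNH (N.inv_mem hσN)⟩ (by
            rw [Subgroup.mem_subgroupOf]; exact N.inv_mem hσN) ⟨v, hvH⟩
          rw [Subgroup.mem_subgroupOf] at this
          simpa using this
        have : σ * (v * σ⁻¹ * v⁻¹) ∈ N := N.mul_mem hσN h1
        simpa [mul_assoc] using this
      · -- in `U₀`: `(σ v σ⁻¹) · v⁻¹` with `U₀ ⊴ Γ`
        have h1 : σ * v * σ⁻¹ ∈ U₀ := hU₀n.conj_mem v hv.2 σ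
        exact U₀.mul_mem h1 (U₀.inv_mem hv.2)
    -- the key lemma
    have hMc : IsClosed ((M : Subgroup Γ) : Set Γ) := by
      rw [hM, Subgroup.coe_inf]
      exact hNc.inter (Subgroup.isClosed_of_isOpen U₀ hU₀o)
    have hkey := hKey V V' M σ hV'o hV'V hMV' hσV hgen hV'n hcomm hMc
    -- `[V : V'] = f` and `[Γ : V'] = f · [Γ : V]`
    have hrel : V'.relIndex V = f := by
      rw [hV', inf_comm, Subgroup.inf_relIndex_right, hf, ← Subgroup.relIndex_sup_left,
        show U₀ ⊔ V = G₁ from le_antisymm (sup_le hU₀G₁ hVG₁)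
          (sup_le le_sup_left ((Subgroup.zpowers_le.mpr hσV).trans le_sup_right))]
    have hidx : V'.index = f * V.index := by
      rw [← Subgroup.relIndex_mul_index hV'V, hrel]
    -- numerics
    rw [hRF V' hV'o, hRF V hVo, hM, ← hd, hidx] at hkey
    have hnum : c * (f * V.index) + 1 ≤ c * V.index + 1 + d := by exact_mod_cast hkey
    have h2 : c * V.index + V.index ≤ c * (f * V.index) := by
      have : V.index + V.index ≤ f * V.index := by nlinarith
      nlinarith
    omega
  -- an admissible subgroup of maximal index
  have hAdmG₁ : Adm G₁ := ⟨hG₁o, inf_le_right, le_rfl⟩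
  set n₀ := Nat.findGreatest (fun n => ∃ V, Adm V ∧ V.index = n) d with hn₀
  obtain ⟨V₀, hV₀, hV₀idx⟩ : ∃ V, Adm V ∧ V.index = n₀ :=
    Nat.findGreatest_spec (P := fun n => ∃ V, Adm V ∧ V.index = n) (hbound G₁ hAdmG₁) ⟨G₁, hAdmG₁, rfl⟩
  haveI : Finite (Γ ⧸ V₀) := Subgroup.quotient_finite_of_isOpen V₀ hV₀.1
  haveI hV₀fi : V₀.FiniteIndex := Subgroup.finiteIndex_of_finite_quotient
  -- `V₀` lies in every admissible `V`
  have hV₀le : ∀ V, Adm V → V₀ ≤ V := by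
    intro V hV
    have hAdm' : Adm (V ⊓ V₀) :=
      ⟨hV.1.inter hV₀.1, le_inf hV.2.1 hV₀.2.1, inf_le_right.trans hV₀.2.2⟩
    have hle : (V ⊓ V₀).index ≤ n₀ :=
      Nat.le_findGreatest (P := fun n => ∃ V, Adm V ∧ V.index = n) (hbound _ hAdm') ⟨_, hAdm', rfl⟩
    have hge : V₀.index ≤ (V ⊓ V₀).index :=
      Nat.le_of_dvd (Nat.pos_of_ne_zero (by
        haveI : Finite (Γ ⧸ (V ⊓ V₀)) := Subgroup.quotient_finite_of_isOpen _ hAdm'.1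
        exact (Subgroup.finiteIndex_of_finite_quotient (H := V ⊓ V₀)).index_ne_zero))
        (Subgroup.index_dvd_of_le inf_le_right)
    have heq : V ⊓ V₀ = V₀ :=
      eq_of_le_of_index_eq inf_le_right hV₀fi.index_ne_zero (le_antisymm (hV₀idx ▸ hle) hge)
    exact (le_of_eq heq.symm).trans inf_le_left
  -- hence `V₀ ≤ N ∩ G₁`: a closed subgroup of a profinite group is the meet of the opens above it
  have hN₁c : IsClosed ((N ⊓ G₁ : Subgroup Γ) : Set Γ) :=
    hNc.inter (Subgroup.isClosed_of_isOpen G₁ hG₁o)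
  have hN₁ : (N ⊓ G₁ : Subgroup Γ) =
      sInf {W : Subgroup Γ | IsOpen (W : Set Γ) ∧ N ⊓ G₁ ≤ W} :=
    ProfiniteGrp.closedSubgroup_eq_sInf_open ⟨N ⊓ G₁, hN₁c⟩
  have hV₀N₁ : V₀ ≤ N ⊓ G₁ := by
    rw [hN₁]
    refine le_sInf fun W hW => ?_
    exact (hV₀le (W ⊓ G₁) ⟨hW.1.inter hG₁o, le_inf hW.2 inf_le_right, inf_le_right⟩).trans inf_le_left
  -- so `N` has finite index: contradiction
  haveI : (N ⊓ G₁).FiniteIndex := Subgroup.finiteIndex_of_le hV₀N₁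
  exact hNinf (Subgroup.finiteIndex_of_le (inf_le_left : N ⊓ G₁ ≤ N))

end Literature.AnabelianGeometry.AbsoluteAnabelian

end
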